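import Summits.BirchSwinnertonDyer.Rank1Residual.X11b.CoinvariantsDescent
import Summits.BirchSwinnertonDyer.Rank1Residual.X11b.LevelLiftingWithP
import Summits.BirchSwinnertonDyer.Rank1Residual.X11b.AnticyclotomicSelmerDual
import Summits.BirchSwinnertonDyer.Rank1Residual.X11b.AnticyclotomicControlAtoms
import Summits.BirchSwinnertonDyer.Rank1Residual.X11b.AnticyclotomicInfinitePlaces
import Summits.BirchSwinnertonDyer.Rank1Residual.X11b.RelaxedSelmerFinite
import Summits.BirchSwinnertonDyer.Rank1Residual.X11b.LocalPrimaryFinite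
import Summits.BirchSwinnertonDyer.Rank1Residual.X11b.GlobalH2FiniteSupport
import Literature.NumberTheory.EllipticCurves.HasseWeilGoodReduction
import Literature.NumberTheory.EllipticCurves.PeriodIndexSupport
import HarnessLib

/-!
# X11b, route R1 — atom (L10) `CoinvariantsTrivialAt` from `H²(K, E[p^∞]) = 0`: JSW17 Lemma 3.3.3
# in the `K_∞`-formulation, by descent + local lifts + Poitou–Tate surgery

HONEST FRAMING (cell `b2b-bsdres`, run/shared/lean/b2b/bsd-rank1-residual/, verbatim in every
file): the goal of the cell is to DELETE the COMBINATION-SHAPED residual classes of the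
Birch–Swinnerton-Dyer formula for ALL analytic-rank `≤ 1` elliptic curves over `ℚ` — "full BSD
formula for every rank `≤ 1` curve in class `C`" assembled STRICTLY from published theorems — so
that the rank-`≤ 1` remainder becomes exactly the CONSTRUCTION-SHAPED classes, which are TYPED
(missing-input `Prop`s), NOT attempted. This is not "finishing BSD". Sub-cell
`b2b-bsdres-multr1-p1` (X11b, route R1 = Castella 2018 Thm. A re-proved along the author's
erratum); a RESEARCH ROUTE; no claim beyond the stated class; X11b stays CONSTRUCTION-SHAPED;
nothing here changes a label; no named fact is minted (theorems only; no `sorry`); CONDITIONAL on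
the cited `poitouTate_selmerStructure_duality K` and `localEulerPoincareCharacteristic (K_v)`.

## What this file does

**`coinvariantsTrivialAt_of_subsingleton`**: for an elliptic curve `W` over a TOTALLY COMPLEX number
field `K`, a `ℤ_p`-extension `κ` with topological generator `γ`, primes `𝔭 ≠ 𝔮` above `p` with
`E[p^∞]^{Γ_{K_𝔭}} = 0` (the erratum's (iv)) and `Sel_𝔮(K, E[p^∞])` FINITE ((P6) at the conjugate):
`H²(K, E[p^∞]) = 0 ⟹ CoinvariantsTrivialAt W p κ 𝔭 γ`, i.e. `conj_γ − 1` is ONTO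
`Sel_𝔭(K_∞, E[p^∞])`.  Proof (JSW17 Lemma 3.3.3, both halves, on the tree's objects): given
`x ∈ Sel`, (1) `y₀ ∈ H¹(K_∞, E[p^∞])` with `conj_γ y₀ − y₀ = x` (`H² = 0`, procyclic descent);
(2) `conj_g y₀ ≡ y₀ mod Sel` for all `g ∈ Γ_K`; (3) at every finite `v ∤ p` and at `𝔭`, a lift
`Ψ_v ∈ H¹(D_v, E[p^∞])` of `res_{K_∞,w} y₀`, zero at the good `v` where the cocycle of `y₀` is
unramified (all but finitely many); (4) Poitou–Tate surgery (`levelLiftingP_of_finite`): a global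
`g ∈ H¹(K, E[p^∞])` with `loc_v g = Ψ_v` on the finite exceptional set and at `𝔭`, locally trivial
at the other `v ∤ p`; (5) `y = y₀ − res g ∈ Sel` and `conj_γ y − y = x`.

References: [JetchevSkinnerWan2017] Lemma 3.3.3, Prop. 3.3.2 (arXiv:1512.06894 pp. 11–12);
[Castella2018] Def. 2.2, Thm. 2.3 (arXiv:1704.06608 p. 5); [GreenbergLNM1716] §3.
-/

noncomputable section

open scoped Classical

open CategoryTheory Function Field NumberField IsDedekindDomain
open Literature.NumberTheory.GaloisRepresentations Literature.NumberTheory.EllipticCurves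
open Literature.NumberTheory.EllipticCurves.GreenbergSelmer
open Literature.NumberTheory.GaloisCohomology

namespace Summit.BirchSwinnertonDyer.Rank1Residual.X11b.Coinv

open Summit.BirchSwinnertonDyer.Rank1Residual.X11b.ProcyclicDescent (kerK)
open Summit.BirchSwinnertonDyer.Rank1Residual.X11b.LocBridge
open Summit.BirchSwinnertonDyer.Rank1Residual.X11b.AcSelmer
open Summit.BirchSwinnertonDyer.Rank1Residual.X11b.H2Support

variable {K : Type} [Field K] [NumberField K] (W : WeierstrassCurve K) [W.IsElliptic] (p : ℕ)
  [Fact p.Prime] (κ : ZpExtension K p)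

/-! ## §1. Bookkeeping: invariants, the exceptional set, finiteness of the relaxed group -/

omit [W.IsElliptic] [Fact p.Prime] in
/-- `E[p^∞]^{Γ_{K_𝔭}} = 0 ⟹ E[p^∞]^{Γ_K} = 0`. [cite: Castella2018Erratum, Thm. 1.1 (iv)] -/
theorem noInvariants_of_noInvariants_at {𝔭 : HeightOneSpectrum (𝓞 K)}
    (hΓ𝔭 : ∀ Q : W.geomPrimaryTorsion p,
      (∀ σ : absoluteGaloisGroup (𝔭.adicCompletion K),
        GaloisRep.restrictField (𝔭.adicCompletion K) (primaryGaloisModule W p) σ Q = Q) → Q = 0)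
    (Q : W.geomPrimaryTorsion p)
    (hQ : ∀ σ : absoluteGaloisGroup K, primaryGaloisModule W p σ Q = Q) : Q = 0 :=
  hΓ𝔭 Q fun _ ↦ hQ _

omit [Fact p.Prime] in
/-- **The exceptional set is finite**: the places `v ∤ p` that are bad for `W` or whose inertia
group is not inside a given open normal subgroup `N₁ ≤ Γ_K` (finitely many bad places;
`eventually_forall_inertia_le`). [cite: SilvermanAEC2009, Rem. VIII.1.3]
[cite: NeukirchANT1999, Ch. II §7] -/
theorem finite_exceptional (N₁ : OpenNormalSubgroup (absoluteGaloisGroup K)) :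
    {v : HeightOneSpectrum (𝓞 K) | ((p : ℕ) : 𝓞 K) ∉ v.asIdeal ∧
      (¬ W.HasGoodReductionAt v ∨
        ¬ (adicCompletionPrime K v).inertia (absoluteGaloisGroup K) ≤ (N₁ : Subgroup _))}.Finite :=
    by
  have hev := (W.eventually_hasGoodReductionAt).and
    (eventually_forall_inertia_le (N₁ : Subgroup (absoluteGaloisGroup K)) N₁.isOpen)
  refine (Filter.eventually_cofinite.mp hev).subset fun v hv h ↦ ?_
  rcases hv.2 with hbad | hI
  · exact hbad h.1
  · exact hI (h.2 _ (adicCompletionPrime_mem_primesAbove K v))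

/-- **Finiteness of the relaxed conjugate group** on any finite set of places away from `p`, from
`Finite (Sel_𝔮(K, E[p^∞]))` and Milne I 2.8 at the completions (gen 15's reduction).
[cite: GreenbergLNM1716, §3 Lemma 3.3 (p. 87)] [cite: MilneADT2006, I Thm. 2.8] -/
theorem finite_relaxed {𝔮 : HeightOneSpectrum (𝓞 K)}
    (hEP : ∀ v : HeightOneSpectrum (𝓞 K), localEulerPoincareCharacteristic (v.adicCompletion K))
    (hfin : Finite (selmerAcBase W p 𝔮 ∅)) {R : Set (HeightOneSpectrum (𝓞 K))} (hR : R.Finite)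
    (hRp : ∀ v ∈ R, ((p : ℕ) : 𝓞 K) ∉ v.asIdeal) :
    Finite (acStructure (primaryGaloisModule W p) p 𝔮 R).selmerGroup := by
  haveI := hfin
  have hfin0 : Finite (acStructure (primaryGaloisModule W p) p 𝔮
      (∅ : Set (HeightOneSpectrum (𝓞 K)))).selmerGroup := by
    refine Nat.finite_of_card_ne_zero ?_
    rw [← natCard_selmerAcBase_eq_natCard_selmerGroup W p 𝔮 ∅]
    exact Nat.card_pos.ne'
  exact finite_selmerGroup_acStructure_of_finite_empty _ p 𝔮 R hR hfin0
    fun v hv _ ↦ finite_galoisCohomology_one_primary_toLocal W p v (hEP v) (hRp v hv)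

/-! ## §2. The theorem -/

/-- **(L10) `CoinvariantsTrivialAt` from `H²(K, E[p^∞]) = 0`** (JSW17 Lemma 3.3.3 in route R1's
`K_∞`-formulation).  Hypotheses: `K` totally complex; the cited Poitou–Tate fact for `K` and Milne
I 2.8 at the completions; `𝔭 ≠ 𝔮` above `p`; `E[p^∞]^{Γ_{K_𝔭}} = 0` ((iv)); `Sel_𝔮(K, E[p^∞])`
finite ((P6) at `𝔮`); `H²(K, E[p^∞]) = 0` (weak Leopoldt); `γ` a topological generator of `κ`.
Conclusion: `conj_γ − 1` is onto `Sel_𝔭(K_∞, E[p^∞])`.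
[cite: JetchevSkinnerWan2017, Lemma 3.3.3 and Prop. 3.3.2 (arXiv:1512.06894 pp. 11–12)]
[cite: Castella2018, Thm. 2.3 (arXiv:1704.06608 p. 5)] -/
theorem coinvariantsTrivialAt_of_subsingleton [IsTotallyComplex K]
    (hPT : poitouTate_selmerStructure_duality K)
    (hEP : ∀ v : HeightOneSpectrum (𝓞 K), localEulerPoincareCharacteristic (v.adicCompletion K))
    {𝔭 𝔮 : HeightOneSpectrum (𝓞 K)} (h𝔭 : ((p : ℕ) : 𝓞 K) ∈ 𝔭.asIdeal)
    (h𝔮 : ((p : ℕ) : 𝓞 K) ∈ 𝔮.asIdeal) (hne : 𝔮 ≠ 𝔭)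
    (hΓ𝔭 : ∀ Q : W.geomPrimaryTorsion p,
      (∀ σ : absoluteGaloisGroup (𝔭.adicCompletion K),
        GaloisRep.restrictField (𝔭.adicCompletion K) (primaryGaloisModule W p) σ Q = Q) → Q = 0)
    (hfin : Finite (selmerAcBase W p 𝔮 ∅))
    (h2 : Subsingleton (galoisCohomology (primaryGaloisModule W p) 2))
    {γ : absoluteGaloisGroup K} (hγ : κ.IsTopGenerator γ) :
    CoinvariantsTrivialAt W p κ 𝔭 γ := by
  intro x
  have hM : ∀ m : W.geomPrimaryTorsion p, IsOpen {σ : absoluteGaloisGroup K | σ • m = m} :=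
    isOpen_stabilizer_geomPrimaryTorsion W p
  have hΓ := noInvariants_of_noInvariants_at W p hΓ𝔭
  -- (1) `y₀` with `conj_γ y₀ - y₀ = x`
  obtain ⟨y₀, hy₀⟩ :=
    exists_conjH1_sub_eq_of_subsingleton W p κ h2 hγ (x : W.subgroupH1 p κ.kerSubgroup)
  -- (2) all conjugates of `y₀` agree with `y₀` modulo `Sel`
  have hSel : ∀ g : absoluteGaloisGroup K,
      W.conjH1 p κ.kerSubgroup g y₀ - y₀ ∈ selmerAc W p κ 𝔭 ∅ :=
    conjH1_sub_mem_selmerAc_of_isTopGenerator hγ (by rw [hy₀]; exact x.2)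
  -- the cocycle of `y₀` and its zero set
  obtain ⟨φ, hφ⟩ := oneCocycleClass_surjective _ y₀
  obtain ⟨N₁, hN₁⟩ := exists_openNormalSubgroup_forall_apply_eq_zero (K := K) φ
  -- the exceptional set `Σ'` (finite, away from `p`)
  set S' : Set (HeightOneSpectrum (𝓞 K)) := {v | ((p : ℕ) : 𝓞 K) ∉ v.asIdeal ∧
    (¬ W.HasGoodReductionAt v ∨
      ¬ (adicCompletionPrime K v).inertia (absoluteGaloisGroup K) ≤ (N₁ : Subgroup _))} with hS'
  have hS'fin : S'.Finite := finite_exceptional W p N₁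
  have hSp : ∀ v ∈ S', ((p : ℕ) : 𝓞 K) ∉ v.asIdeal := fun v hv ↦ hv.1
  -- (3) the local lifts
  have hz : ∀ v : HeightOneSpectrum (𝓞 K), (((p : ℕ) : 𝓞 K) ∉ v.asIdeal ∨ v = 𝔭) →
      ∃ z : subgroupH1 (decomp (K := K) v) (W.geomPrimaryTorsion p),
        ResKernel.resSubgroup (kerD κ v) (W.geomPrimaryTorsion p) z =
          resKerD κ (W.geomPrimaryTorsion p) v y₀ := fun v hv ↦
    exists_resSubgroup_kerD_eq v (hv.imp (fun h ↦ ⟨h, Set.notMem_empty v⟩) id) hSel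
  choose z hz using hz
  -- at the good unramified `v ∉ Σ'`, `v ∤ p`: `Ψ_v = 0` and `y₀` is locally trivial
  have hzero : ∀ (v : HeightOneSpectrum (𝓞 K)) (hpv : ((p : ℕ) : 𝓞 K) ∉ v.asIdeal), v ∉ S' →
      resKerD κ (W.geomPrimaryTorsion p) v y₀ = 0 := by
    intro v hpv hvS
    have hgood : W.HasGoodReductionAt v := by
      by_contra h; exact hvS ⟨hpv, Or.inl h⟩
    have hI : (adicCompletionPrime K v).inertia (absoluteGaloisGroup K) ≤ (N₁ : Subgroup _) := by
      by_contra h; exact hvS ⟨hpv, Or.inr h⟩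
    have h := hz v (Or.inl hpv)
    rw [← hφ] at h ⊢
    exact (eq_zero_of_inertia_le hpv hgood φ hN₁ hI (z v (Or.inl hpv)) h).2
  -- the finite set `T` of places: `∞ ∪ {v ∣ p} ∪ Σ'`
  have hp0 : p ≠ 0 := (Fact.out : p.Prime).ne_zero
  set T : Finset (Place K) := (Finset.univ.image Sum.inl) ∪
    (((finite_setOf_natCast_mem (K := K) p hp0).toFinset ∪ hS'fin.toFinset).image Sum.inr) with hT
  have hinf : ∀ w : InfinitePlace K, (Sum.inl w : Place K) ∈ T := fun w ↦
    Finset.mem_union_left _ (Finset.mem_image_of_mem _ (Finset.mem_univ w))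
  have hpT : ∀ v : HeightOneSpectrum (𝓞 K), ((p : ℕ) : 𝓞 K) ∈ v.asIdeal →
      (Sum.inr v : Place K) ∈ T := fun v hv ↦
    Finset.mem_union_right _ (Finset.mem_image_of_mem _
      (Finset.mem_union_left _ ((Set.Finite.mem_toFinset _).mpr hv)))
  have hSig : ∀ v ∈ S', (Sum.inr v : Place K) ∈ T := fun v hv ↦
    Finset.mem_union_right _ (Finset.mem_image_of_mem _
      (Finset.mem_union_right _ ((Set.Finite.mem_toFinset _).mpr hv)))
  have hbad : ∀ v : HeightOneSpectrum (𝓞 K), ¬ W.HasGoodReductionAt v →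
      (Sum.inr v : Place K) ∈ T := by
    intro v hv
    by_cases hpv : ((p : ℕ) : 𝓞 K) ∈ v.asIdeal
    · exact hpT v hpv
    · exact hSig v ⟨hpv, Or.inl hv⟩
  have hRfin : {v : HeightOneSpectrum (𝓞 K) | (Sum.inr v : Place K) ∈ T ∧
      ((p : ℕ) : 𝓞 K) ∉ v.asIdeal}.Finite :=
    (T.finite_toSet.preimage Sum.inr_injective.injOn).subset fun v hv ↦ hv.1
  have hfinR := finite_relaxed W p (𝔮 := 𝔮) hEP hfin hRfin (fun v hv ↦ hv.2)
  -- the family of local classes on `Σ'⁺ = Σ' ∪ {𝔭}` and a common killing exponent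
  have hmem : ∀ v : (insert 𝔭 S' : Set (HeightOneSpectrum (𝓞 K))),
      ((p : ℕ) : 𝓞 K) ∉ (v : HeightOneSpectrum (𝓞 K)).asIdeal ∨
        (v : HeightOneSpectrum (𝓞 K)) = 𝔭 :=
    fun v ↦ (Set.mem_insert_iff.mp v.2).elim Or.inr fun h ↦ Or.inl h.1
  let τ : ∀ v : (insert 𝔭 S' : Set (HeightOneSpectrum (𝓞 K))),
      galoisCohomology
        ((primaryGaloisModule W p).toLocal (Sum.inr (v : HeightOneSpectrum (𝓞 K)))) 1 :=
    fun v ↦ inflDecomp hM (v : HeightOneSpectrum (𝓞 K)) (z v (hmem v))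
  obtain ⟨K₀, hK₀⟩ := exists_pow_nsmul_family_eq_zero (hS'fin.insert 𝔭) τ
  -- (4) Poitou–Tate surgery
  obtain ⟨N, xN, hxN, hloc⟩ := levelLiftingP_of_finite W p 𝔭 S' T hPT
    (fun w ↦ IsTotallyComplex.isComplex w) hΓ hΓ𝔭 h𝔭 h𝔮 hne hSp hinf hpT hSig hbad hfinR K₀ τ hK₀
  set g : galoisCohomology (primaryGaloisModule W p) 1 :=
    galoisCohomology.map (Levels.primaryInclusion W p N) 1 xN with hg
  -- (5) the corrected class
  set y : W.subgroupH1 p κ.kerSubgroup :=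
    y₀ - ResKernel.resSubgroup κ.kerSubgroup (W.geomPrimaryTorsion p) (toDiscreteH1 hM g) with hy
  have hconj : ∀ σ : absoluteGaloisGroup K, W.conjH1 p κ.kerSubgroup σ y =
      y + (W.conjH1 p κ.kerSubgroup σ y₀ - y₀) := by
    intro σ
    rw [hy, map_sub, conjH1_resSubgroup]
    abel
  -- the local computation of `y`
  have hresy : ∀ (v : HeightOneSpectrum (𝓞 K)), resKerD κ (W.geomPrimaryTorsion p) v y =
      resKerD κ (W.geomPrimaryTorsion p) v y₀ -
        ResKernel.resSubgroup (kerD κ v) (W.geomPrimaryTorsion p)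
          (ResKernel.resSubgroup (decomp v) (W.geomPrimaryTorsion p) (toDiscreteH1 hM g)) := by
    intro v
    rw [hy, map_sub, resKerD_resSubgroup]
  have haway : ∀ (v : HeightOneSpectrum (𝓞 K)), (((p : ℕ) : 𝓞 K) ∉ v.asIdeal ∨ v = 𝔭) →
      y ∈ awayKer κ.kerSubgroup (W.geomPrimaryTorsion p) v := by
    intro v hv
    rw [mem_awayKer_iff_resKerD_eq_zero, hresy]
    by_cases hvI : v ∈ insert 𝔭 S'
    · -- prescribed place: `loc_v g = infl Ψ_v`
      have hl := hloc ⟨v, hvI⟩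
      have e : ResKernel.resSubgroup (decomp v) (W.geomPrimaryTorsion p) (toDiscreteH1 hM g) =
          z v (hmem ⟨v, hvI⟩) :=
        resSubgroup_decomp_eq_of_localization_eq hM v g _ hl
      rw [e, hz, sub_self]
    · -- other place away from `p`: `loc_v g = 0` and `y₀` locally trivial
      have hpv : ((p : ℕ) : 𝓞 K) ∉ v.asIdeal := by
        rcases hv with h | rfl
        · exact h
        · exact (hvI (Set.mem_insert _ _)).elim
      have hvS : v ∉ S' := fun h ↦ hvI (Set.mem_insert_of_mem _ h)
      have h0 : galoisCohomology.localization (primaryGaloisModule W p) (Sum.inr v) 1 g = 0 :=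
        localization_map_primaryInclusion_eq_zero_of_mem_upperStructureP W p N 𝔭 S' hxN h𝔭 hpv hvS
      rw [resSubgroup_decomp_eq_zero_of_localization_eq_zero hM v g h0, map_zero, sub_zero]
      exact hzero v hpv hvS
  have hySel : y ∈ selmerAc W p κ 𝔭 ∅ := by
    change y ∈ selmerOver κ.kerSubgroup (W.geomPrimaryTorsion p) p 𝔭 ∅
    rw [mem_selmerOver_iff_awayKer]
    refine ⟨fun v hpv _ σ ↦ ?_, fun w σ ↦ ?_, fun σ ↦ ?_⟩
    · rw [hconj]
      exact add_mem (haway v (Or.inl hpv)) ((mem_awayKer_iff_resKerD_eq_zero κ v _).2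
        (resKerD_eq_zero_of_mem_selmerAc (Or.inl ⟨hpv, Set.notMem_empty v⟩) (hSel σ)))
    · exact mem_infKer_of_decompInf_eq_bot w
        (decompInf_eq_bot_of_isComplex (IsTotallyComplex.isComplex w)) _
    · rw [hconj]
      exact add_mem (haway 𝔭 (Or.inr rfl)) ((mem_awayKer_iff_resKerD_eq_zero κ 𝔭 _).2
        (resKerD_eq_zero_of_mem_selmerAc (Or.inr rfl) (hSel σ)))
  refine ⟨⟨y, hySel⟩, Subtype.ext ?_⟩
  change W.conjH1 p κ.kerSubgroup γ y - y = (x : W.subgroupH1 p κ.kerSubgroup)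
  rw [hconj, hy₀]
  abel

end Summit.BirchSwinnertonDyer.Rank1Residual.X11b.Coinv

end
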